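import Literature.NumberTheory.DiophantineGeometry.SUnitCubeDecompositionProofs
import Literature.NumberTheory.DiophantineGeometry.OptimizedHeightBoundsPropTenSevenProofs
import Literature.NumberTheory.DiophantineGeometry.MordellPrimitiveSolutionsHeightBoundsProofs
import HarnessLib

/-!
# von Känel–Matschke, Cor. 9.1 (generalized Ramanujan–Nagell equations) from Prop. 10.7 and from the §10
# roots — the printed proof of §9 in kernel

Topic `Literature/NumberTheory/DiophantineGeometry` (family `abc`). Theorems only — NO definition, NO new named
fact (D-0014, D-0026). R. von Känel, B. Matschke, arXiv:1605.06079 = Mem. AMS 286 (2023) no. 1419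
[`VonkanelMatschke2023`], §9, proof of Cor. 9.1 (`cor:ranabounds`): *"We write `y = ε y'³` with `y' ∈ 𝒪^×` and
`ε ∈ ℤ_{≥1}` dividing `N_S²`. Then `u = ε c y'` and `v = ε c x` satisfy the Mordell equation `v² = u³ + a'` with
`a' = −b(εc)²`. It holds that `a' ≠ 0` and `a'_S = a_S`, since `bc ≠ 0` and `ε ∈ 𝒪^×`. Thus Proposition
(prop:algobounds) implies Corollary (cor:ranabounds)."*

## What is proved here

* `isSInteger_mul`, `mordellLevel_mul_of_isSUnit` (`(ta)_S = a_S` for `t ∈ 𝒪^×`: the sentence "`a'_S = a_S`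
  since `ε ∈ 𝒪^×`"), `padicValNat_num_eq_max` (`ord_p` of the numerator is `max(ord_p, 0)`).
* `corollary_9_1_of_mordell_omegaOpt` — **Cor. 9.1 ⇐ the Mordell half of Prop. 10.7** (`max(h(u), (2/3)h(v))
  ≤ Ω_opt(a', S)` for Mordell solutions over `𝒪`), with the bookkeeping the print leaves implicit: the
  decomposition is taken with `ord_p(ε) ∈ {−1, 0, 1}` (`exists_eq_mul_cube_of_isSUnit`, `h(ε) ≤ log N_S`), and
  `Ω_opt(a', S) ≤ Ω_opt(a, S) + (2/3)h(ε)` since `h(a') ≤ h(a) + 2h(ε)` while `a'_S = a_S`; then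
  `h(x²) ≤ 3Ω_opt + 4 log N_S + 2h(c)` and `h(y) ≤ 3Ω_opt + 6 log N_S + 3h(c)`, both within the printed
  `3Ω_opt + 3h(c) + 8 log N_S`. (With the printed `ε ∣ N_S²`, i.e. `h(ε) ≤ 2 log N_S`, this bookkeeping would give
  `12 log N_S` for `h(y)`; the symmetric choice is what makes the printed constant come out.)
* `corollary_9_1_of_proposition_10_7`, **`corollary_9_1_of_roots`** (⇐ {modularity, Lemma 10.3, Prop. 10.8 (i)}
  through `mordell_height_le_omegaOpt_of_lemma_10_3`), and the compositions `corollary_9_1_sim_of_roots`,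
  `corollaryK_log_of_roots` (the `2a_S log a_S` form of Cor. K, `MordellPrimitiveSolutionsHeightBoundsProofs`).

No `abc` claim; axioms standard.
-/

noncomputable section

open Height
open Literature.NumberTheory.EllipticCurves.ModularForms

namespace Literature.NumberTheory.DiophantineGeometry

namespace VonKanelMatschke

/-! ### `𝒪` is a ring; `(ta)_S = a_S` for `t ∈ 𝒪^×` -/

/-- `𝒪 = ℤ[1/N_S]` is closed under multiplication (the denominator of a product divides the product of the
denominators). [cite: VonkanelMatschke2023, §1 (𝒪 = ℤ[1/N_S])] -/
theorem isSInteger_mul {S : Finset ℕ} {x y : ℚ} (hx : IsSInteger S x) (hy : IsSInteger S y) :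
    IsSInteger S (x * y) := by
  intro p hp
  have hsub : (x * y).den.primeFactors ⊆ (x.den * y.den).primeFactors :=
    Nat.primeFactors_mono (Rat.mul_den_dvd x y) (mul_ne_zero x.den_nz y.den_nz)
  have hp' := hsub hp
  rw [Nat.primeFactors_mul x.den_nz y.den_nz, Finset.mem_union] at hp'
  exact hp'.elim (fun h => hx h) (fun h => hy h)

/-- `𝒪` is closed under negation. [cite: VonkanelMatschke2023, §1 (𝒪 = ℤ[1/N_S])] -/
theorem isSInteger_neg {S : Finset ℕ} {x : ℚ} (hx : IsSInteger S x) : IsSInteger S (-x) := by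
  unfold IsSInteger at hx ⊢
  rwa [Rat.den_neg_eq_den]

/-- `ord_p` of the numerator of a nonzero rational is `max(ord_p, 0)` (numerator and denominator are coprime).
[folklore] -/
private theorem padicValNat_num_eq_max {q : ℚ} (hq : q ≠ 0) {p : ℕ} (hp : p.Prime) :
    (padicValNat p q.num.natAbs : ℤ) = max (padicValRat p q) 0 := by
  haveI : Fact p.Prime := ⟨hp⟩
  have hnum0 : q.num.natAbs ≠ 0 := Int.natAbs_ne_zero.mpr (Rat.num_ne_zero.mpr hq)
  rw [padicValRat_def, padicValInt]
  by_cases hd : p ∣ q.num.natAbs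
  · have hnd : ¬ p ∣ q.den := fun hd' =>
      hp.one_lt.ne' (Nat.eq_one_of_dvd_one (q.reduced ▸ Nat.dvd_gcd hd hd'))
    rw [padicValNat.eq_zero_of_not_dvd hnd, Nat.cast_zero, sub_zero, max_eq_left (by positivity)]
  · rw [padicValNat.eq_zero_of_not_dvd hd, Nat.cast_zero, zero_sub, max_eq_right]
    simp

/-- **"`a'_S = a_S` since `ε ∈ 𝒪^×`"**: `mordellLevel S (t · a) = mordellLevel S a` for `t ∈ 𝒪^×`, `a ≠ 0` (for a
prime `p ∉ S`, `ord_p(ta) = ord_p(a)`, and `r₂` only sees the primes outside `S`).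
[cite: VonkanelMatschke2023, §9 (proof of Cor. 9.1: a'_S = a_S)] -/
theorem mordellLevel_mul_of_isSUnit {S : Finset ℕ} {t a : ℚ} (ht : IsSUnit S t) (ha : a ≠ 0) :
    mordellLevel S (t * a) = mordellLevel S a := by
  have hta : t * a ≠ 0 := mul_ne_zero ht.1 ha
  have hval : ∀ p : ℕ, p.Prime → p ∉ S → padicValRat p (t * a) = padicValRat p a := by
    intro p hp hpS
    haveI : Fact p.Prime := ⟨hp⟩
    rw [padicValRat.mul ht.1 ha, padicValRat_eq_zero_of_isSUnit ht hp hpS, zero_add]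
  have hnat : ∀ p : ℕ, p.Prime → p ∉ S → padicValNat p (t * a).num.natAbs = padicValNat p a.num.natAbs := by
    intro p hp hpS
    have h1 := padicValNat_num_eq_max hta hp
    have h2 := padicValNat_num_eq_max ha hp
    rw [hval p hp hpS] at h1
    exact_mod_cast h1.trans h2.symm
  have hset : (t * a).num.natAbs.primeFactors \ S = a.num.natAbs.primeFactors \ S := by
    ext p
    simp only [Finset.mem_sdiff, Nat.mem_primeFactors, ne_eq, Int.natAbs_eq_zero, Rat.num_eq_zero]
    constructor
    · rintro ⟨⟨hp, hdvd, -⟩, hpS⟩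
      haveI : Fact p.Prime := ⟨hp⟩
      refine ⟨⟨hp, ?_, ha⟩, hpS⟩
      have h1 : 1 ≤ padicValNat p (t * a).num.natAbs :=
        one_le_padicValNat_of_dvd (Int.natAbs_ne_zero.mpr (Rat.num_ne_zero.mpr hta)) hdvd
      rw [hnat p hp hpS] at h1
      exact dvd_of_one_le_padicValNat h1
    · rintro ⟨⟨hp, hdvd, -⟩, hpS⟩
      haveI : Fact p.Prime := ⟨hp⟩
      refine ⟨⟨hp, ?_, hta⟩, hpS⟩
      have h1 : 1 ≤ padicValNat p a.num.natAbs :=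
        one_le_padicValNat_of_dvd (Int.natAbs_ne_zero.mpr (Rat.num_ne_zero.mpr ha)) hdvd
      rw [← hnat p hp hpS] at h1
      exact dvd_of_one_le_padicValNat h1
  rw [mordellLevel_def, mordellLevel_def, hset]
  congr 1
  refine Finset.prod_congr rfl fun p hp => ?_
  obtain ⟨hp1, hp2⟩ := Finset.mem_sdiff.mp hp
  rw [hnat p (Nat.prime_of_mem_primeFactors hp1) hp2]

/-- `−t²` is an `S`-unit for `t ∈ 𝒪^×`. [cite: VonkanelMatschke2023, §1 (eq:sunit)] -/
theorem isSUnit_neg_sq {S : Finset ℕ} {t : ℚ} (ht : IsSUnit S t) : IsSUnit S (-t ^ 2) :=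
  isSUnit_of_padicValRat_eq_zero (neg_ne_zero.mpr (pow_ne_zero 2 ht.1)) fun p hp hpS => by
    haveI : Fact p.Prime := ⟨hp⟩
    rw [padicValRat.neg, padicValRat.pow, padicValRat_eq_zero_of_isSUnit ht hp hpS, mul_zero]

/-! ### Cor. 9.1 from the Mordell half of Prop. 10.7 -/

/-- **vKM Cor. 9.1 ⟸ Prop. 10.7 (Mordell half)** (the printed proof of §9, PROVED; see the module docstring for
the bookkeeping): if every Mordell solution over `𝒪` satisfies `max(h(u), (2/3)h(v)) ≤ Ω_opt(a', S)`, then every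
solution of `x² + b = cy`, `(x, y) ∈ 𝒪 × 𝒪^×`, satisfies `h(x²), h(y) ≤ 3Ω_opt(bc², S) + 3h(c) + 8 log N_S`.
[cite: VonkanelMatschke2023, Cor. 9.1 (arXiv §9, cor:ranabounds) with its proof] -/
theorem corollary_9_1_of_mordell_omegaOpt
    (h : ∀ (S : Finset ℕ), (∀ p ∈ S, p.Prime) → ∀ a : ℚ, a ≠ 0 → IsSInteger S a →
      ∀ x y : ℚ, IsSInteger S x → IsSInteger S y → y ^ 2 = x ^ 3 + a →
        max (logHeight₁ x) (2 / 3 * logHeight₁ y) ≤ omegaOpt S a) :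
    corollary_9_1 := by
  intro S hS b c hb hc hbS hcS x y hx hy hxy
  obtain ⟨ε, w, hε, hw, hyw, hhε⟩ := exists_eq_mul_cube_of_isSUnit hS hy
  have hε0 : ε ≠ 0 := hε.1
  have hw0 : w ≠ 0 := hw.1
  set a : ℚ := b * c ^ 2 with ha
  have ha0 : a ≠ 0 := mul_ne_zero hb (pow_ne_zero 2 hc)
  have haS : IsSInteger S a := isSInteger_mul hbS (by rw [pow_two]; exact isSInteger_mul hcS hcS)
  -- the Mordell equation `v² = u³ + a'`, `a' = −ε²·a`
  set t : ℚ := -ε ^ 2 with ht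
  have htS : IsSUnit S t := isSUnit_neg_sq hε
  set a' : ℚ := t * a with ha'
  set u : ℚ := ε * c * w with hu
  set v : ℚ := ε * c * x with hv
  have ha'0 : a' ≠ 0 := mul_ne_zero htS.1 ha0
  have ha'S : IsSInteger S a' := isSInteger_mul htS.isSInteger haS
  have huS : IsSInteger S u := isSInteger_mul (isSInteger_mul hε.isSInteger hcS) hw.isSInteger
  have hvS : IsSInteger S v := isSInteger_mul (isSInteger_mul hε.isSInteger hcS) hx
  have hsol : v ^ 2 = u ^ 3 + a' := by
    rw [hv, hu, ha', ht, ha]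
    linear_combination (ε ^ 2 * c ^ 2) * hxy + (ε ^ 2 * c ^ 3) * hyw
  have hΩ := h S hS a' ha'0 ha'S u v huS hvS hsol
  -- `Ω_opt(a') ≤ Ω_opt(a) + (2/3) h(ε)`
  have hlev : mordellLevel S a' = mordellLevel S a := mordellLevel_mul_of_isSUnit htS ha0
  have hha' : logHeight₁ a' ≤ 2 * logHeight₁ ε + logHeight₁ a := by
    have h1 := logHeight₁_mul_le t a
    have h2 : logHeight₁ t = 2 * logHeight₁ ε := by rw [ht, logHeight₁_neg, logHeight₁_pow]; push_cast; ring
    rw [ha']; linarith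
  have hΩ' : omegaOpt S a' ≤ omegaOpt S a + 2 / 3 * logHeight₁ ε := by
    rw [omegaOpt_def, omegaOpt_def, hlev]; linarith
  -- heights of `x² = (v/(εc))²` and `y = ε (u/(εc))³`
  have hεc0 : ε * c ≠ 0 := mul_ne_zero hε0 hc
  have hhεc : logHeight₁ ((ε * c)⁻¹) ≤ logHeight₁ ε + logHeight₁ c := by
    rw [logHeight₁_inv]; exact logHeight₁_mul_le ε c
  have hxe : x = v * (ε * c)⁻¹ := by rw [hv]; field_simp
  have hwe : w = u * (ε * c)⁻¹ := by rw [hu]; field_simp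
  have hhx : logHeight₁ x ≤ logHeight₁ v + logHeight₁ ε + logHeight₁ c := by
    have := logHeight₁_mul_le v ((ε * c)⁻¹); rw [← hxe] at this; linarith
  have hhw : logHeight₁ w ≤ logHeight₁ u + logHeight₁ ε + logHeight₁ c := by
    have := logHeight₁_mul_le u ((ε * c)⁻¹); rw [← hwe] at this; linarith
  have hhy : logHeight₁ y ≤ logHeight₁ ε + 3 * logHeight₁ w := by
    have := logHeight₁_mul_le ε (w ^ 3); rw [← hyw, logHeight₁_pow] at this; push_cast at this; linarith
  have hx2 : logHeight₁ (x ^ 2) = 2 * logHeight₁ x := by rw [logHeight₁_pow]; push_cast; ring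
  have hu' : logHeight₁ u ≤ omegaOpt S a' := (le_max_left _ _).trans hΩ
  have hv' : logHeight₁ v ≤ 3 / 2 * omegaOpt S a' := by
    have := (le_max_right _ _).trans hΩ; linarith
  have hc0 : 0 ≤ logHeight₁ c := zero_le_logHeight₁ c
  have hN0 : 0 ≤ Real.log (primesProd S) := Real.log_nonneg (by exact_mod_cast one_le_primesProd hS)
  rw [hx2]
  exact max_le (by linarith) (by linarith)

/-- **Cor. 9.1 ⟸ Prop. 10.7.** [cite: VonkanelMatschke2023, Cor. 9.1 (arXiv §9) with Prop. 10.7 (prop:algobounds)] -/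
theorem corollary_9_1_of_proposition_10_7 (h107 : proposition_10_7) : corollary_9_1 :=
  corollary_9_1_of_mordell_omegaOpt h107.2

/-- **Cor. 9.1 from the vKM §10 roots** {modularity, Lemma 10.3, Prop. 10.8 (i)} (the Mordell half of
Prop. 10.7 being `mordell_height_le_omegaOpt_of_lemma_10_3`). The named fact `corollary_9_1` is no longer an
independent root. [cite: VonkanelMatschke2023, Cor. 9.1 (arXiv §9) with §10.3 and §10.5.1] -/
theorem corollary_9_1_of_roots (hmod : nonempty_modularParametrizationData)
    (h103 : vonKanelMatschke_lemma_10_3) (hi : vonKanelMatschke_prop_10_8_i) : corollary_9_1 :=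
  corollary_9_1_of_mordell_omegaOpt (mordell_height_le_omegaOpt_of_lemma_10_3 hmod h103 hi)

/-- **The simplified Cor. 9.1 (`Ω_sim`) from the roots.** [cite: VonkanelMatschke2023, §9 (Cor. 9.1 with Ω_opt ≤ Ω_sim)] -/
theorem corollary_9_1_sim_of_roots (hmod : nonempty_modularParametrizationData)
    (h103 : vonKanelMatschke_lemma_10_3) (hi : vonKanelMatschke_prop_10_8_i) : corollary_9_1_sim :=
  corollary_9_1_sim_of' (corollary_9_1_of_roots hmod h103 hi)

/-- **Cor. K in the `2a_S log a_S` form its printed proof supports, from the roots** (see the FINDING in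
`MordellPrimitiveSolutionsHeightBoundsProofs`). [cite: VonkanelMatschke2023, Corollary K (§1.2.3) and §9] -/
theorem corollaryK_log_of_roots (hmod : nonempty_modularParametrizationData)
    (h103 : vonKanelMatschke_lemma_10_3) (hi : vonKanelMatschke_prop_10_8_i) :
    ∀ (S : Finset ℕ), (∀ p ∈ S, p.Prime) → ∀ b c : ℚ, b ≠ 0 → c ≠ 0 → IsSInteger S b → IsSInteger S c →
      ∀ x y : ℚ, IsSInteger S x → IsSUnit S y → x ^ 2 + b = c * y →
        max (2 * logHeight₁ x) (logHeight₁ y) ≤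
          2 * (mordellLevel S (b * c ^ 2) : ℝ) * Real.log (mordellLevel S (b * c ^ 2)) +
            logHeight₁ (b * c ^ 2) + 3 * logHeight₁ c :=
  corollaryK_log_of_corollary_9_1 (corollary_9_1_of_roots hmod h103 hi)

end VonKanelMatschke

end Literature.NumberTheory.DiophantineGeometry

end
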